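import Summits.CriticalPhenomena.PercolationContinuityZ3.Theorems.PercNearOneGluingNoHeavyLowerTailSahiCTCKleitmanPivotCredits
import HarnessLib

/-!
# `NoHeavyLowerTail` (crux stmt-CriticalPhenomena-4575), P3 lane: LEMMA A-f — the strengthened Kleitman inequality WITH EXPLICIT SPARE:
# `kap ≥ #{bad common edges avoiding f} + #{pivot sets of f}` for loop-free traces and any free point `f` (memo g48 §4c)

Support file (seat `prim-l12-p3`, gen 48; `--supports stmt-CriticalPhenomena-4575`).  Memo
`run/shared/lean/prim/prim-l12/FROM-prim-l12-p3-g48-THREE-BLOCK-SLOTS.md` §4c.  Setting and pivot sets: `…SahiCTCKleitmanPivotCredits`.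
* **`card_badEdges_avoiding_add_pivotSets_le_kap`** ("LEMMA A-f"): for two up-sets with loop-free traces on `(D, s)` and `f ∈ s`,
  `#{common edges c ⊆ s, f ∉ c, with D ∪ (s ∖ c) not a common member} + #{T ⊆ s ∖ {f} : D ∪ T in neither, D ∪ T ∪ {f} in both} ≤ kap 𝒳 𝒵 D s`.
  Every common edge `{f, h}` contributes the pivot set `{h}`, so this refines `card_cubeBadEdges_le_kap` (…SahiCTCKleitmanCommonEdges) and exhibits
  EXPLICIT spare credits of an r-slot of the three-block form: one per GOOD common edge at `f` and one per pivot set of size `≠ 1` — the currency of the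
  c-slot transfer of memo g48 §4–§5.
Proof: the induction of `card_cubeBadEdges_le_kap` peeling a vertex `v ≠ f` (of common degree ≥ 2 among the vertices `≠ f` when possible): the deletion
term is the induction hypothesis, the link term pays the pivot sets through `v` (`card_pivotSets_le_kap`, and one more by
`card_pivotSets_add_one_le_kap_of_loop` in the single-edge obstruction), the mixed term pays the bad edges through `v` by the doubly-pivotal witnesses.
Nothing is asserted about the crux.
-/

namespace Summit.CriticalPhenomena.PercolationContinuityZ3.Theorems.SahiCTCForms

open Finset

variable {α : Type*} [DecidableEq α]

/-! ### Lemma A-f: bad common edges avoiding `f` plus the pivot sets of `f` -/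

section LemmaAf
variable {𝒳 𝒵 : Finset (Finset α)}

/-- **LEMMA A-f (explicit spare of the strengthened Kleitman inequality).**  For two up-sets whose traces on the sub-cube `(D, s)` are loop-free
and any free point `f ∈ s`: the number of common edges AVOIDING `f` whose co-set is not a common member, plus the number of pivot sets of `f`,
is at most `kap 𝒳 𝒵 D s`.  (Every common edge `{f, h}` yields the pivot set `{h}`, so this refines `card_cubeBadEdges_le_kap` and leaves one
explicit spare credit per GOOD common edge at `f` and per pivot set of size `≠ 1`.) [this work] -/
theorem card_badEdges_avoiding_add_pivotSets_le_kap (h𝒳 : IsUpperSet (𝒳 : Set (Finset α))) (h𝒵 : IsUpperSet (𝒵 : Set (Finset α))) :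
    ∀ (n : ℕ) (s D : Finset α) (f : α), #s ≤ n → Disjoint D s → f ∈ s → (∀ u ∈ s, insert u D ∉ 𝒳) → (∀ u ∈ s, insert u D ∉ 𝒵) →
      (#(((s.powerset.filter fun c => #c = 2 ∧ D ∪ c ∈ 𝒳 ∧ D ∪ c ∈ 𝒵).filter
          fun c => ¬ (D ∪ (s \ c) ∈ 𝒳 ∧ D ∪ (s \ c) ∈ 𝒵)).filter fun c => f ∉ c) : ℤ)
        + #((s.erase f).powerset.filter fun T => D ∪ T ∉ 𝒳 ∧ D ∪ T ∉ 𝒵 ∧ D ∪ insert f T ∈ 𝒳 ∧ D ∪ insert f T ∈ 𝒵)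
        ≤ kap 𝒳 𝒵 D s := by
  intro n
  induction n with
  | zero =>
    intro s D f hs _ hf
    exact absurd (card_pos.2 ⟨f, hf⟩) (by omega)
  | succ n ih =>
    intro s D f hs hDs hfs hLX hLZ
    set G := s.powerset.filter fun c => #c = 2 ∧ D ∪ c ∈ 𝒳 ∧ D ∪ c ∈ 𝒵 with hGdef
    set Bd := G.filter fun c => ¬ (D ∪ (s \ c) ∈ 𝒳 ∧ D ∪ (s \ c) ∈ 𝒵) with hBddef
    set BdF := Bd.filter fun c => f ∉ c with hBdFdef
    set PS := (s.erase f).powerset.filter fun T => D ∪ T ∉ 𝒳 ∧ D ∪ T ∉ 𝒵 ∧ D ∪ insert f T ∈ 𝒳 ∧ D ∪ insert f T ∈ 𝒵 with hPS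
    have hPSle : (#PS : ℤ) ≤ kap 𝒳 𝒵 D s := card_pivotSets_le_kap h𝒳 h𝒵 (n + 1) s D f hs hDs hfs
    -- if every common edge contains `f`, there is nothing beyond the pivot sets to pay
    by_cases hGf : ∀ c ∈ G, f ∈ c
    · have hB : BdF = ∅ := filter_eq_empty_iff.2 fun c hc hfc => hfc (hGf c (cubeBadEdges_subset hc))
      rw [hB, card_empty, Nat.cast_zero, zero_add]; exact hPSle
    push Not at hGf
    obtain ⟨c₀, hc₀G, hfc₀⟩ := hGf
    -- choose the recursion vertex `v ≠ f` on a common edge, of common degree ≥ 2 when some vertex `≠ f` has it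
    have hchoice : ∃ v ∈ s, v ≠ f ∧ (∃ c ∈ G, v ∈ c) ∧
        ((∃ c₁ ∈ G, ∃ c₂ ∈ G, c₁ ≠ c₂ ∧ v ∈ c₁ ∧ v ∈ c₂) ∨
          (∀ u ∈ s, u ≠ f → ∀ c₁ ∈ G, ∀ c₂ ∈ G, u ∈ c₁ → u ∈ c₂ → c₁ = c₂)) := by
      by_cases hdeg : ∃ u ∈ s, u ≠ f ∧ ∃ c₁ ∈ G, ∃ c₂ ∈ G, c₁ ≠ c₂ ∧ u ∈ c₁ ∧ u ∈ c₂
      · obtain ⟨u, hu, huf, c₁, hc₁, c₂, hc₂, hne, hu1, hu2⟩ := hdeg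
        exact ⟨u, hu, huf, ⟨c₁, hc₁, hu1⟩, Or.inl ⟨c₁, hc₁, c₂, hc₂, hne, hu1, hu2⟩⟩
      · push Not at hdeg
        obtain ⟨hc₀s, hc₀2, -⟩ := mem_cubeCommonEdges.1 hc₀G
        obtain ⟨x, y, -, hxy⟩ := card_eq_two.1 hc₀2
        have hx : x ∈ c₀ := by rw [hxy]; simp
        have hxf : x ≠ f := fun h => hfc₀ (h ▸ hx)
        refine ⟨x, hc₀s hx, hxf, ⟨c₀, hc₀G, hx⟩, Or.inr fun u hu huf c₁ hc₁ c₂ hc₂ h1 h2 => ?_⟩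
        by_contra hne
        exact hdeg u hu huf c₁ hc₁ c₂ hc₂ hne h1 |>.elim h2
    obtain ⟨v, hvs, hvf, ⟨c₁, hc₁G, hvc₁⟩, hstar⟩ := hchoice
    have hvD : v ∉ D := fun h => disjoint_left.1 hDs h hvs
    obtain ⟨w₀, hw₀s, hw₀v, hc₁eq⟩ := exists_pair_of_mem_cubeCommonEdges hc₁G hvc₁
    obtain ⟨-, -, hc₁X, hc₁Z⟩ := mem_cubeCommonEdges.1 hc₁G
    -- the recursion at `v`
    set s' := s.erase v with hs'def
    have hs' : #s' ≤ n := by rw [hs'def, card_erase_of_mem hvs]; omega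
    have hDs' : Disjoint D s' := Disjoint.mono_right (erase_subset v s) hDs
    have hDvs' : Disjoint (insert v D) s' := by rw [disjoint_insert_left]; exact ⟨notMem_erase v s, hDs'⟩
    have hfs' : f ∈ s' := mem_erase.2 ⟨hvf.symm, hfs⟩
    rw [kap_rec h𝒳 h𝒵 hvs hvD]
    set J := ((tr 𝒳 (insert v D) s' \ tr 𝒳 D s').filter fun R =>
        s' \ R ∈ tr 𝒵 (insert v D) s' ∧ s' \ R ∉ tr 𝒵 D s') with hJdef
    have hJ0 : (0 : ℤ) ≤ #J := Nat.cast_nonneg _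
    -- the three lower bounds: deletion (induction), link (pivot credits), and their `PS`-split
    have hIH := ih s' D f hs' hDs' hfs' (fun u hu => hLX u (mem_of_mem_erase hu)) (fun u hu => hLZ u (mem_of_mem_erase hu))
    have hlink : (#((s'.erase f).powerset.filter fun T => insert v D ∪ T ∉ 𝒳 ∧ insert v D ∪ T ∉ 𝒵 ∧
        insert v D ∪ insert f T ∈ 𝒳 ∧ insert v D ∪ insert f T ∈ 𝒵) : ℤ) ≤ kap 𝒳 𝒵 (insert v D) s' :=
      card_pivotSets_le_kap h𝒳 h𝒵 n s' (insert v D) f hs' hDvs' hfs'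
    have hPSsplit : (#PS : ℤ) ≤ #((s'.erase f).powerset.filter fun T => D ∪ T ∉ 𝒳 ∧ D ∪ T ∉ 𝒵 ∧ D ∪ insert f T ∈ 𝒳 ∧ D ∪ insert f T ∈ 𝒵)
        + #((s'.erase f).powerset.filter fun T => insert v D ∪ T ∉ 𝒳 ∧ insert v D ∪ T ∉ 𝒵 ∧
          insert v D ∪ insert f T ∈ 𝒳 ∧ insert v D ∪ insert f T ∈ 𝒵) := by
      have hsplit : #PS = #(PS.filter fun T => v ∉ T) + #(PS.filter fun T => v ∈ T) := by
        rw [← card_filter_add_card_filter_not (s := PS) (fun T => v ∉ T)]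
        congr 2; ext T; simp only [mem_filter, not_not]
      have hA : #(PS.filter fun T => v ∉ T) ≤
          #((s'.erase f).powerset.filter fun T => D ∪ T ∉ 𝒳 ∧ D ∪ T ∉ 𝒵 ∧ D ∪ insert f T ∈ 𝒳 ∧ D ∪ insert f T ∈ 𝒵) := by
        refine card_le_card fun T hT => ?_
        obtain ⟨hT, hvT⟩ := mem_filter.1 hT
        obtain ⟨hTs, h⟩ := mem_pivotSets.1 hT
        refine mem_pivotSets.2 ⟨fun x hx => ?_, h⟩
        have := mem_erase.1 (hTs hx)
        exact mem_erase.2 ⟨this.1, mem_erase.2 ⟨fun h => hvT (h ▸ hx), this.2⟩⟩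
      have hB : #(PS.filter fun T => v ∈ T) ≤
          #((s'.erase f).powerset.filter fun T => insert v D ∪ T ∉ 𝒳 ∧ insert v D ∪ T ∉ 𝒵 ∧
            insert v D ∪ insert f T ∈ 𝒳 ∧ insert v D ∪ insert f T ∈ 𝒵) := by
        refine card_le_card_of_injOn (fun T => T.erase v) (fun T hT => ?_) (fun T hT T' hT' h => ?_)
        · obtain ⟨hT, hvT⟩ := mem_filter.1 (mem_coe.1 hT)
          obtain ⟨hTs, h⟩ := mem_pivotSets.1 hT
          refine mem_coe.2 (mem_pivotSets.2 ⟨fun x hx => ?_, ?_⟩)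
          · have hx' := mem_erase.1 hx
            have := mem_erase.1 (hTs hx'.2)
            exact mem_erase.2 ⟨this.1, mem_erase.2 ⟨hx'.1, this.2⟩⟩
          · rw [insert_union_erase_of_mem D hvT, insert_union_insert_erase_of_mem D hvT]; exact h
        · have h1 : v ∈ T := (mem_filter.1 (mem_coe.1 hT)).2
          have h2 : v ∈ T' := (mem_filter.1 (mem_coe.1 hT')).2
          have h' : T.erase v = T'.erase v := h
          rw [← insert_erase h1, h', insert_erase h2]
      have := hsplit ▸ Nat.add_le_add hA hB
      exact_mod_cast this
    -- bad edges avoiding `f`: those avoiding `v` are bad edges of the facet, those through `v` need witnesses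
    have hsplitB : (#BdF : ℤ) = #(BdF.filter fun c => v ∉ c) + #(BdF.filter fun c => v ∈ c) := by
      rw [← card_filter_add_card_filter_not (s := BdF) (fun c => v ∈ c)]; push_cast; ring
    have hT1 : #(BdF.filter fun c => v ∉ c) ≤ #(((s'.powerset.filter fun c => #c = 2 ∧ D ∪ c ∈ 𝒳 ∧ D ∪ c ∈ 𝒵).filter
        fun c => ¬ (D ∪ (s' \ c) ∈ 𝒳 ∧ D ∪ (s' \ c) ∈ 𝒵)).filter fun c => f ∉ c) := by
      refine card_le_card fun c hc => ?_
      obtain ⟨hcBdF, hvc⟩ := mem_filter.1 hc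
      obtain ⟨hcBd, hfc⟩ := mem_filter.1 hcBdF
      obtain ⟨hcG, hbad⟩ := mem_cubeBadEdges.1 hcBd
      obtain ⟨hcs, hc2, hcX, hcZ⟩ := mem_cubeCommonEdges.1 hcG
      have hcs' : c ⊆ s' := fun x hx => mem_erase.2 ⟨fun h => hvc (h ▸ hx), hcs hx⟩
      have hsub : D ∪ (s' \ c) ⊆ D ∪ (s \ c) := union_subset_union Subset.rfl (sdiff_subset_sdiff (erase_subset v s) Subset.rfl)
      exact mem_filter.2 ⟨mem_cubeBadEdges.2 ⟨mem_cubeCommonEdges.2 ⟨hcs', hc2, hcX, hcZ⟩, fun h => hbad ⟨h𝒳 hsub h.1, h𝒵 hsub h.2⟩⟩, hfc⟩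
    -- facts about a common edge through `v`
    have hedge : ∀ c ∈ G, v ∈ c → ∃ w, w ∈ s ∧ w ≠ v ∧ c = {v, w} ∧ c.erase v = {w} ∧ c ⊆ s ∧
        insert v D ∪ c.erase v = D ∪ c ∧ D ∪ c.erase v = insert w D := by
      intro c hcG hvc
      obtain ⟨w, hws, hwv, hceq⟩ := exists_pair_of_mem_cubeCommonEdges hcG hvc
      have hce : c.erase v = {w} := by rw [hceq]; exact pair_erase_left hwv
      refine ⟨w, hws, hwv, hceq, hce, (mem_cubeCommonEdges.1 hcG).1, insert_union_erase_eq D hvc, ?_⟩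
      rw [hce, union_singleton_eq_insert]
    by_cases hbad : ∃ c ∈ BdF, v ∈ c ∧
        ¬ ((D ∪ (s \ c) ∉ 𝒵 ∧ insert v D ∪ (s \ c) ∈ 𝒵) ∨ (D ∪ (s \ c) ∉ 𝒳 ∧ insert v D ∪ (s \ c) ∈ 𝒳))
    · -- a bad edge through `v` without witness: then `G = {c}`, `f ∉ c`, and the link term has one spare credit
      obtain ⟨c, hcBdF, hvc, hngood⟩ := hbad
      obtain ⟨hcBd, hfc⟩ := mem_filter.1 hcBdF
      obtain ⟨hcG, hcbad⟩ := mem_cubeBadEdges.1 hcBd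
      obtain ⟨w, hws, hwv, hceq, hce, hcs, hc1, hc2⟩ := hedge c hcG hvc
      have hallw : ∀ c' ∈ G, w ∈ c' := by
        intro c' hc'G
        by_contra hwc'
        obtain ⟨hc's, -, hc'X, hc'Z⟩ := mem_cubeCommonEdges.1 hc'G
        have hsub : D ∪ c' ⊆ insert v D ∪ (s \ c) := by
          intro x hx
          rcases mem_union.1 hx with hx | hx
          · exact mem_union_left _ (mem_insert_of_mem hx)
          · by_cases hxv : x = v
            · exact mem_union_left _ (hxv ▸ mem_insert_self v D)
            · refine mem_union_right _ (mem_sdiff.2 ⟨hc's hx, fun hxc => ?_⟩)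
              rw [hceq, mem_insert, mem_singleton] at hxc
              rcases hxc with hxc | hxc
              · exact hxv hxc
              · exact hwc' (hxc ▸ hx)
        push Not at hngood
        rcases not_and_or.1 hcbad with hX | hZ
        · exact (hngood.2 hX) (h𝒳 hsub hc'X)
        · exact (hngood.1 hZ) (h𝒵 hsub hc'Z)
      have hwf : w ≠ f := fun h => hfc (by rw [hceq, ← h]; exact mem_insert_of_mem (mem_singleton_self w))
      -- `G = {c}`
      have hGone : ∀ c' ∈ G, c' = c := by
        intro c' hc'
        rcases hstar with ⟨c₁', hc₁', c₂', hc₂', hne, hv1, hv2⟩ | huniq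
        · exfalso; apply hne
          obtain ⟨w₁, -, -, h1eq, -⟩ := hedge c₁' hc₁' hv1
          obtain ⟨w₂, -, -, h2eq, -⟩ := hedge c₂' hc₂' hv2
          have hw1 : w = w₁ := by
            have := hallw c₁' hc₁'; rw [h1eq, mem_insert, mem_singleton] at this
            rcases this with h | h; exact absurd h hwv; exact h
          have hw2 : w = w₂ := by
            have := hallw c₂' hc₂'; rw [h2eq, mem_insert, mem_singleton] at this
            rcases this with h | h; exact absurd h hwv; exact h
          rw [h1eq, h2eq, ← hw1, ← hw2]
        · exact huniq w hws hwf c' hc' c hcG (hallw c' hc') (hallw c hcG)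
      have hBle : #BdF ≤ 1 := by
        refine le_trans (card_le_card ((filter_subset _ _).trans cubeBadEdges_subset)) (card_le_one.2 fun c₁ hc₁ c₂ hc₂ => ?_)
        rw [hGone c₁ hc₁, hGone c₂ hc₂]
      -- the link term pays the pivot sets over `D + v` and one more: `D + v + f` is not common since `{v, f} ≠ c`
      have hvf : ¬ (insert v D ∪ insert f ∅ ∈ 𝒳 ∧ insert v D ∪ insert f ∅ ∈ 𝒵) := by
        intro h
        have heq : insert v D ∪ insert f ∅ = D ∪ {v, f} := by
          rw [insert_empty, union_singleton_eq_insert, union_insert, union_singleton_eq_insert, Finset.insert_comm]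
        rw [heq] at h
        have hvfG : ({v, f} : Finset α) ∈ G := by
          refine mem_cubeCommonEdges.2 ⟨?_, card_pair hvf, h.1, h.2⟩
          intro x hx; rw [mem_insert, mem_singleton] at hx
          rcases hx with rfl | rfl; exact hvs; exact hfs
        have hmem : f ∈ ({v, f} : Finset α) := mem_insert_of_mem (mem_singleton_self f)
        rw [hGone _ hvfG] at hmem
        exact hfc hmem
      have hw₀' : w ∈ s' := mem_erase.2 ⟨hwv, hws⟩
      have hDvw : insert w (insert v D) = D ∪ c := by
        rw [hceq, union_insert, union_singleton_eq_insert, Finset.insert_comm]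
      obtain ⟨-, -, hcX, hcZ⟩ := mem_cubeCommonEdges.1 hcG
      have hlink1 := card_pivotSets_add_one_le_kap_of_loop h𝒳 h𝒵 (hLX v hvs) (hLZ v hvs) hw₀'
        (by rw [hDvw]; exact hcX) (by rw [hDvw]; exact hcZ) f hvf
      have hdel : (#((s'.erase f).powerset.filter fun T => D ∪ T ∉ 𝒳 ∧ D ∪ T ∉ 𝒵 ∧ D ∪ insert f T ∈ 𝒳 ∧ D ∪ insert f T ∈ 𝒵) : ℤ)
          ≤ kap 𝒳 𝒵 D s' := card_pivotSets_le_kap h𝒳 h𝒵 n s' D f hs' hDs' hfs'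
      have : (#BdF : ℤ) ≤ 1 := by exact_mod_cast hBle
      linarith
    · -- every bad edge through `v` avoiding `f` has a witness in `J`
      push Not at hbad
      have hT3 : #(BdF.filter fun c => v ∈ c) ≤ #J := by
        refine card_le_card_of_injOn (fun c => if D ∪ (s \ c) ∉ 𝒵 ∧ insert v D ∪ (s \ c) ∈ 𝒵 then c.erase v else s \ c)
          (fun c hc => ?_) (fun c₁ hc₁ c₂ hc₂ heq => ?_)
        · obtain ⟨hcBdF, hvc⟩ := mem_filter.1 (mem_coe.1 hc)
          obtain ⟨hcBd, -⟩ := mem_filter.1 hcBdF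
          obtain ⟨hcG, hcbad⟩ := mem_cubeBadEdges.1 hcBd
          obtain ⟨w, hws, hwv, hceq, hce, hcs, hc1, hc2⟩ := hedge c hcG hvc
          obtain ⟨-, -, hcX, hcZ⟩ := mem_cubeCommonEdges.1 hcG
          have hgood := hbad c hcBdF hvc
          have hsub1 : c.erase v ⊆ s' := fun x hx => mem_erase.2 ⟨(mem_erase.1 hx).1, hcs (mem_of_mem_erase hx)⟩
          have hsub2 : s \ c ⊆ s' := fun x hx => mem_erase.2 ⟨fun h => (mem_sdiff.1 hx).2 (h ▸ hvc), (mem_sdiff.1 hx).1⟩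
          refine mem_coe.2 ?_
          rw [mem_filter, mem_sdiff]
          dsimp only
          by_cases hA : D ∪ (s \ c) ∉ 𝒵 ∧ insert v D ∪ (s \ c) ∈ 𝒵
          · rw [if_pos hA]
            refine ⟨⟨mem_tr.2 ⟨hsub1, by rw [hc1]; exact hcX⟩, fun h => hLX w hws (by rw [← hc2]; exact (mem_tr.1 h).2)⟩, ?_, ?_⟩
            · rw [erase_sdiff_erase_eq hvc]; exact mem_tr.2 ⟨hsub2, hA.2⟩
            · rw [erase_sdiff_erase_eq hvc]; exact fun h => hA.1 (mem_tr.1 h).2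
          · rw [if_neg hA]
            have hB : D ∪ (s \ c) ∉ 𝒳 ∧ insert v D ∪ (s \ c) ∈ 𝒳 := hgood.resolve_left hA
            refine ⟨⟨mem_tr.2 ⟨hsub2, hB.2⟩, fun h => hB.1 (mem_tr.1 h).2⟩, ?_, ?_⟩
            · rw [erase_sdiff_sdiff_eq hcs]; exact mem_tr.2 ⟨hsub1, by rw [hc1]; exact hcZ⟩
            · rw [erase_sdiff_sdiff_eq hcs]; exact fun h => hLZ w hws (by rw [← hc2]; exact (mem_tr.1 h).2)
        · obtain ⟨hc₁BdF, hvc₁⟩ := mem_filter.1 (mem_coe.1 hc₁)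
          obtain ⟨hc₂BdF, hvc₂⟩ := mem_filter.1 (mem_coe.1 hc₂)
          have hc₁G := (mem_cubeBadEdges.1 (mem_filter.1 hc₁BdF).1).1
          have hc₂G := (mem_cubeBadEdges.1 (mem_filter.1 hc₂BdF).1).1
          obtain ⟨w₁, hw₁s, hw₁v, hc₁eq, hc₁e, hc₁s, -, hc₁2⟩ := hedge c₁ hc₁G hvc₁
          obtain ⟨w₂, hw₂s, hw₂v, hc₂eq, hc₂e, hc₂s, -, hc₂2⟩ := hedge c₂ hc₂G hvc₂
          have key1 : ∀ c : Finset α, v ∈ c → insert v (c.erase v) = c := fun c h => insert_erase h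
          have key2 : ∀ c : Finset α, c ⊆ s → s \ (s \ c) = c := fun c h => Finset.sdiff_sdiff_eq_self h
          have mixed : ∀ {c c' : Finset α}, c ∈ G → c' ∈ G → v ∈ c → v ∈ c' → c ⊆ s →
              c.erase v = s \ c' → ¬ (D ∪ (s \ c') ∉ 𝒵 ∧ insert v D ∪ (s \ c') ∈ 𝒵) → False := by
            intro c c' hcG hc'G hvc hvc' hcs h hnA
            obtain ⟨w, hws, hwv, hceq, hce, -, -, hcD⟩ := hedge c hcG hvc
            obtain ⟨-, -, -, hcZ⟩ := mem_cubeCommonEdges.1 hcG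
            apply hnA
            constructor
            · rw [← h, hcD]; exact hLZ w hws
            · have : insert v D ∪ (s \ c') = D ∪ c := by rw [← h]; exact insert_union_erase_eq D hvc
              rw [this]; exact hcZ
          dsimp only at heq
          by_cases hA₁ : D ∪ (s \ c₁) ∉ 𝒵 ∧ insert v D ∪ (s \ c₁) ∈ 𝒵 <;>
            by_cases hA₂ : D ∪ (s \ c₂) ∉ 𝒵 ∧ insert v D ∪ (s \ c₂) ∈ 𝒵
          · rw [if_pos hA₁, if_pos hA₂] at heq
            rw [← key1 c₁ hvc₁, ← key1 c₂ hvc₂, heq]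
          · rw [if_pos hA₁, if_neg hA₂] at heq
            exact (mixed hc₁G hc₂G hvc₁ hvc₂ hc₁s heq hA₂).elim
          · rw [if_neg hA₁, if_pos hA₂] at heq
            exact (mixed hc₂G hc₁G hvc₂ hvc₁ hc₂s heq.symm hA₁).elim
          · rw [if_neg hA₁, if_neg hA₂] at heq
            rw [← key2 c₁ hc₁s, ← key2 c₂ hc₂s, heq]
      have hT3' : (#(BdF.filter fun c => v ∈ c) : ℤ) ≤ #J := by exact_mod_cast hT3
      have hT1' : (#(BdF.filter fun c => v ∉ c) : ℤ) ≤ #(((s'.powerset.filter fun c => #c = 2 ∧ D ∪ c ∈ 𝒳 ∧ D ∪ c ∈ 𝒵).filter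
          fun c => ¬ (D ∪ (s' \ c) ∈ 𝒳 ∧ D ∪ (s' \ c) ∈ 𝒵)).filter fun c => f ∉ c) := by exact_mod_cast hT1
      rw [hsplitB]
      linarith
end LemmaAf

end Summit.CriticalPhenomena.PercolationContinuityZ3.Theorems.SahiCTCForms
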